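import Literature.LinearAlgebra.Matrix.PosDefHermitianPairDiagonalization
import Mathlib.Analysis.Matrix.PosDef
import Mathlib.Analysis.SpecialFunctions.Log.Basic
import HarnessLib

/-!
# S2β · DET-REP (B) — THE `log det` STEP-FACTORISATION HINGE (B1): `log det [[A, B], [Bᴴ, C]] = log det C + log det (A − B C⁻¹ Bᴴ)` for positive definite real
# block matrices, along ANY splitting of the index type, with the 4-point (mixed second difference) ADDITIVITY it induces

Crux `stmt-QuantumFields-20520` (`…Theses.UnitScaleTilt.FluctuationComparisonRegPrIntL`), LINE g18-1 S2β, organ (C3) ∕ DET-REP (B), VALUE ROW DETN; cell `ym3-torus` (HUMAN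
RULING D-0037 — rung R3: continuum `SU(2)` Yang–Mills on `T³`; NOT `d = 4`, NOT infinite volume, NOT a mass gap, NOT Clay); width seat `ym3-torus-px13` g19; definition-free
helper (`--kind proof --supports stmt-QuantumFields-20520 --as helper`, NOT a proof of the crux and NOT of any registered stub).  Theorems only: 0 `def`, 0 `instance`,
0 `notation`, 0 `sorry`; default heartbeats; Mathlib ∕ `Literature.LinearAlgebra` only — NO Yang–Mills object.

WHY (px21 g17 `LOCATE-DETREPB-px21g17.md` §3–§4 brick (B1); ymfull-r3-prover-4 g0 `LOCATE-DETREPB-EDGES-r3p4g0.md` «SECOND»).  The DETN row of `def DetRepB` bounds the mixed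
4-point `Δ²[log det M − 2 log jV]` of the slice Hessian `M` of the action in the tube of record.  Entrywise letters on `M` itself cost `Cst ≳ L^{2(K−J)}` (w5 g15 FINDING #50):
the cancellation lives BETWEEN scales, and print ([Balaban1985UV3] (36)–(37), [Balaban1984PropagatorsII] (1.33)) integrates ONE STEP AT A TIME.  In the tree's one-shot
currency that is the exact identity `log det M = Σ_k log det S_k` — iterated Schur complements of `M` in step-adapted coordinates = iterated Gaussian integration — after which
each `log det S_k` is a local sum with intensive responses (✓`…LocalSumFourPointOneSided`).  THIS FILE is the two-block step of that identity and its bookkeeping, on which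
B2 (the step-adapted flag of px21 g11's tube), B3 (per-step DETN) and the REP organisation-by-scales (px20 g15) hang: positivity of the corner and of the Schur complement
(lit ✓`Literature.LinearAlgebra.Matrix.posDef_of_fromBlocks_posDef₂₂` ∕ ✓`schurComplement₂₂_posDef_of_fromBlocks_posDef`, [HornJohnson2013] Thm 7.7.15 ∕ Obs. 7.1.2), the
determinant factorisation (Mathlib `Matrix.det_fromBlocks₂₂`), hence the `log` identity (`Real.log_mul` on two positive determinants, Mathlib `Matrix.PosDef.det_pos`), its
reindexed form along any `e : p ⊕ q ≃ n` (Mathlib `Matrix.det_submatrix_equiv_self`, `Matrix.fromBlocks_toBlocks`), and the 4-point additivity at four positive definite data.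

WHAT.
* §1 `det_fromBlocks_eq_det_mul_det_schur` (`det H = det C · det (A − B C⁻¹ Bᴴ)`), ★★ `log_det_fromBlocks_eq_add` (the step), `det_schur_pos`, `log_det_fromBlocks_sub_log_det_corner`
  (`log det H − log det C = log det S`: the Gaussian-integration reading «integrating out the `q`-block leaves `log det S`»).
* §2 along any splitting `e : p ⊕ q ≃ n` of a positive definite `M : Matrix n n ℝ`: `posDef_reindex_blocks` (the reindexed matrix IS `fromBlocks A B Bᴴ C` with
  `A = M|_{p×p}`, `B = M|_{p×q}`, `C = M|_{q×q}` read through `e`), ★★ `log_det_eq_add_of_equiv` (`log det M = log det C + log det (A − B C⁻¹ Bᴴ)`) — iterate on `C` along a flag.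
* §3 ★ `fourPt_log_det_eq_add_of_equiv` — for a family `M : X → Matrix n n ℝ` positive definite at four data `U V W Z` and one splitting `e`:
  `Δ²_{UVWZ}[log det M] = Δ²_{UVWZ}[log det C] + Δ²_{UVWZ}[log det S]` (the two-term instance of ✓`fourPt_sum_eq_sum_fourPt`'s shape, stated without importing the S2β cone).

HONEST SCOPE.  Finite-dimensional linear algebra over `ℝ` (bookkeeping over Mathlib + one lit file); proves nothing of B2–B5, DETN, JACW, DET-REP (B), GAP♯, S2β or the crux
20520; rung R3 = SU(2) YM₃ on T³ — NOT d = 4, NOT infinite volume, NOT a mass gap, NOT Clay; the Yang–Mills mass gap is NOT proved.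

References: R. A. Horn, C. R. Johnson, Matrix Analysis, 2nd ed. (2013) [HornJohnson2013] (§0.8.5 Schur complement and (0.8.5.1) p. 25; Thm 7.7.15; Obs. 7.1.2); T. Bałaban,
CMP 102 (1985) 255–275 [Balaban1985UV3] ((36)–(37) p. 265); CMP 96 (1984) 223–250 [Balaban1984PropagatorsII] ((1.33)); J. Dieudonné, Foundations of Modern Analysis (1960)
[Dieudonne1960] (Ch. X §2 (10.2.1), bookkeeping of second differences).
-/

set_option autoImplicit false

noncomputable section

open Matrix
open Literature.LinearAlgebra.Matrix (posDef_of_fromBlocks_posDef₂₂ schurComplement₂₂_posDef_of_fromBlocks_posDef)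

namespace Summit.QuantumFields.YangMills.Theorems.FluctuationComparisonRegPrIntLS2BetaLogDetSchurStep

/-! ## §1 The two-block step -/

section Step

variable {p q : Type*} [Fintype p] [Fintype q] [DecidableEq p] [DecidableEq q]
  {A : Matrix p p ℝ} {B : Matrix p q ℝ} {C : Matrix q q ℝ}

/-- **DETERMINANT FACTORISATION THROUGH THE SCHUR COMPLEMENT** for a positive definite real block matrix `H = [[A, B], [Bᴴ, C]]`: `det H = det C · det (A − B C⁻¹ Bᴴ)`
(Mathlib `Matrix.det_fromBlocks₂₂`, the corner `C` being invertible since positive definite). [cite: HornJohnson2013, §0.8.5 (0.8.5.1) p.25] -/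
theorem det_fromBlocks_eq_det_mul_det_schur (hH : (fromBlocks A B Bᴴ C).PosDef) :
    (fromBlocks A B Bᴴ C).det = C.det * (A - B * C⁻¹ * Bᴴ).det := by
  have hC : C.PosDef := posDef_of_fromBlocks_posDef₂₂ hH
  letI : Invertible C := hC.isUnit.invertible
  rw [det_fromBlocks₂₂, invOf_eq_nonsing_inv]

/-- The Schur complement of the (positive definite) corner has positive determinant. [cite: HornJohnson2013, Thm 7.7.15 and Obs. 7.1.2] -/
theorem det_schur_pos (hH : (fromBlocks A B Bᴴ C).PosDef) : 0 < (A - B * C⁻¹ * Bᴴ).det :=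
  (schurComplement₂₂_posDef_of_fromBlocks_posDef hH).det_pos

omit [DecidableEq p] in
/-- The corner of a positive definite block matrix has positive determinant. [cite: HornJohnson2013, Obs. 7.1.2] -/
theorem det_corner_pos (hH : (fromBlocks A B Bᴴ C).PosDef) : 0 < C.det :=
  (posDef_of_fromBlocks_posDef₂₂ hH).det_pos

/-- ★★ **THE `log det` STEP**: `log det [[A, B], [Bᴴ, C]] = log det C + log det (A − B C⁻¹ Bᴴ)` for a positive definite real block matrix — one step of
«`log det M = Σ_k log det S_k`» (integrating out the `q`-block). [cite: HornJohnson2013, §0.8.5 (0.8.5.1) p.25; Balaban1985UV3, (36)-(37) p.265] -/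
theorem log_det_fromBlocks_eq_add (hH : (fromBlocks A B Bᴴ C).PosDef) :
    Real.log (fromBlocks A B Bᴴ C).det = Real.log C.det + Real.log (A - B * C⁻¹ * Bᴴ).det := by
  rw [det_fromBlocks_eq_det_mul_det_schur hH, Real.log_mul (det_corner_pos hH).ne' (det_schur_pos hH).ne']

/-- The Gaussian-integration reading: `log det H − log det C = log det (A − B C⁻¹ Bᴴ)`. [cite: HornJohnson2013, §0.8.5 (0.8.5.1) p.25] -/
theorem log_det_fromBlocks_sub_log_det_corner (hH : (fromBlocks A B Bᴴ C).PosDef) :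
    Real.log (fromBlocks A B Bᴴ C).det - Real.log C.det = Real.log (A - B * C⁻¹ * Bᴴ).det := by
  rw [log_det_fromBlocks_eq_add hH]; ring

end Step

/-! ## §2 Along any splitting `e : p ⊕ q ≃ n` of the index type -/

section Equiv

variable {n p q : Type*} [Fintype n] [Fintype p] [Fintype q] [DecidableEq n] [DecidableEq p] [DecidableEq q]

omit [Fintype n] [Fintype p] [Fintype q] [DecidableEq n] [DecidableEq p] [DecidableEq q] in
/-- Reindexing a positive definite real matrix along `e : p ⊕ q ≃ n` gives the positive definite block matrix
`[[M|_{p×p}, M|_{p×q}], [(M|_{p×q})ᴴ, M|_{q×q}]]` (symmetry of `M` supplies the lower-left block). [cite: HornJohnson2013, Obs. 7.1.2] -/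
theorem posDef_reindex_blocks {M : Matrix n n ℝ} (hM : M.PosDef) (e : p ⊕ q ≃ n) :
    (fromBlocks (M.submatrix (e ∘ Sum.inl) (e ∘ Sum.inl)) (M.submatrix (e ∘ Sum.inl) (e ∘ Sum.inr))
      (M.submatrix (e ∘ Sum.inl) (e ∘ Sum.inr))ᴴ (M.submatrix (e ∘ Sum.inr) (e ∘ Sum.inr))).PosDef := by
  have hblocks : fromBlocks (M.submatrix (e ∘ Sum.inl) (e ∘ Sum.inl)) (M.submatrix (e ∘ Sum.inl) (e ∘ Sum.inr))
      (M.submatrix (e ∘ Sum.inl) (e ∘ Sum.inr))ᴴ (M.submatrix (e ∘ Sum.inr) (e ∘ Sum.inr)) = M.submatrix e e := by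
    have hsym : ∀ i j, M j i = M i j := fun i j => by
      simpa using congrFun (congrFun hM.1 i) j
    ext i j
    rcases i with i | i <;> rcases j with j | j <;> simp [fromBlocks, hsym]
  rw [hblocks]
  exact hM.submatrix e.injective

/-- The determinant is unchanged by the reindexing. [cite: HornJohnson2013, §0.8.5 p.25] -/
theorem det_reindex_blocks {M : Matrix n n ℝ} (hM : M.PosDef) (e : p ⊕ q ≃ n) :
    (fromBlocks (M.submatrix (e ∘ Sum.inl) (e ∘ Sum.inl)) (M.submatrix (e ∘ Sum.inl) (e ∘ Sum.inr))
      (M.submatrix (e ∘ Sum.inl) (e ∘ Sum.inr))ᴴ (M.submatrix (e ∘ Sum.inr) (e ∘ Sum.inr))).det = M.det := by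
  have hblocks : fromBlocks (M.submatrix (e ∘ Sum.inl) (e ∘ Sum.inl)) (M.submatrix (e ∘ Sum.inl) (e ∘ Sum.inr))
      (M.submatrix (e ∘ Sum.inl) (e ∘ Sum.inr))ᴴ (M.submatrix (e ∘ Sum.inr) (e ∘ Sum.inr)) = M.submatrix e e := by
    have hsym : ∀ i j, M j i = M i j := fun i j => by
      simpa using congrFun (congrFun hM.1 i) j
    ext i j
    rcases i with i | i <;> rcases j with j | j <;> simp [fromBlocks, hsym]
  rw [hblocks, det_submatrix_equiv_self]

/-- ★★ **THE `log det` STEP ALONG ANY SPLITTING**: for `M : Matrix n n ℝ` positive definite and `e : p ⊕ q ≃ n`, with `A := M|_{p×p}`, `B := M|_{p×q}`, `C := M|_{q×q}`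
(read through `e`): `log det M = log det C + log det (A − B C⁻¹ Bᴴ)`.  Iterating on `C` along a flag of splittings gives «`log det M = Σ_k log det S_k`».
[cite: HornJohnson2013, §0.8.5 (0.8.5.1) p.25; Balaban1985UV3, (36)-(37) p.265; Balaban1984PropagatorsII, (1.33)] -/
theorem log_det_eq_add_of_equiv {M : Matrix n n ℝ} (hM : M.PosDef) (e : p ⊕ q ≃ n) :
    Real.log M.det = Real.log (M.submatrix (e ∘ Sum.inr) (e ∘ Sum.inr)).det +
      Real.log (M.submatrix (e ∘ Sum.inl) (e ∘ Sum.inl) -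
        M.submatrix (e ∘ Sum.inl) (e ∘ Sum.inr) * (M.submatrix (e ∘ Sum.inr) (e ∘ Sum.inr))⁻¹ *
          (M.submatrix (e ∘ Sum.inl) (e ∘ Sum.inr))ᴴ).det := by
  rw [← det_reindex_blocks hM e, log_det_fromBlocks_eq_add (posDef_reindex_blocks hM e)]

omit [Fintype n] [DecidableEq n] [DecidableEq p] in
/-- Positivity along the splitting (for the next step of the iteration: the corner `C = M|_{q×q}` and the Schur complement are again positive definite).
[cite: HornJohnson2013, Obs. 7.1.2 and Thm 7.7.15] -/
theorem posDef_corner_of_equiv {M : Matrix n n ℝ} (hM : M.PosDef) (e : p ⊕ q ≃ n) :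
    (M.submatrix (e ∘ Sum.inr) (e ∘ Sum.inr)).PosDef ∧
      (M.submatrix (e ∘ Sum.inl) (e ∘ Sum.inl) -
        M.submatrix (e ∘ Sum.inl) (e ∘ Sum.inr) * (M.submatrix (e ∘ Sum.inr) (e ∘ Sum.inr))⁻¹ *
          (M.submatrix (e ∘ Sum.inl) (e ∘ Sum.inr))ᴴ).PosDef :=
  ⟨posDef_of_fromBlocks_posDef₂₂ (posDef_reindex_blocks hM e), schurComplement₂₂_posDef_of_fromBlocks_posDef (posDef_reindex_blocks hM e)⟩

end Equiv

/-! ## §3 The 4-point additivity at four positive definite data -/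

section FourPoint

variable {X n p q : Type*} [Fintype n] [Fintype p] [Fintype q] [DecidableEq n] [DecidableEq p] [DecidableEq q]

/-- ★ **`Δ²[log det M] = Δ²[log det C] + Δ²[log det S]`**: for a family `M : X → Matrix n n ℝ` positive definite at the four data `U V W Z` of a window quadrilateral and one
splitting `e`, the mixed second difference of `log det M` is the sum of those of the corner `log det C` and of the Schur complement `log det S` — the two-term shape of
✓`…LocalSumFourPointOneSided.fourPt_sum_eq_sum_fourPt`; iterate along a flag for «`Δ² log det M = Σ_k Δ² log det S_k`».
[cite: Dieudonne1960, Ch. X §2 (10.2.1) (bookkeeping); Balaban1985UV3, (36)-(37) p.265] -/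
theorem fourPt_log_det_eq_add_of_equiv (M : X → Matrix n n ℝ) (e : p ⊕ q ≃ n) (U V W Z : X)
    (hU : (M U).PosDef) (hV : (M V).PosDef) (hW : (M W).PosDef) (hZ : (M Z).PosDef) :
    (Real.log (M U).det - Real.log (M V).det) - (Real.log (M W).det - Real.log (M Z).det) =
      ((Real.log ((M U).submatrix (e ∘ Sum.inr) (e ∘ Sum.inr)).det - Real.log ((M V).submatrix (e ∘ Sum.inr) (e ∘ Sum.inr)).det) -
        (Real.log ((M W).submatrix (e ∘ Sum.inr) (e ∘ Sum.inr)).det - Real.log ((M Z).submatrix (e ∘ Sum.inr) (e ∘ Sum.inr)).det)) +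
      ((Real.log ((M U).submatrix (e ∘ Sum.inl) (e ∘ Sum.inl) -
            (M U).submatrix (e ∘ Sum.inl) (e ∘ Sum.inr) * ((M U).submatrix (e ∘ Sum.inr) (e ∘ Sum.inr))⁻¹ *
              ((M U).submatrix (e ∘ Sum.inl) (e ∘ Sum.inr))ᴴ).det -
          Real.log ((M V).submatrix (e ∘ Sum.inl) (e ∘ Sum.inl) -
            (M V).submatrix (e ∘ Sum.inl) (e ∘ Sum.inr) * ((M V).submatrix (e ∘ Sum.inr) (e ∘ Sum.inr))⁻¹ *
              ((M V).submatrix (e ∘ Sum.inl) (e ∘ Sum.inr))ᴴ).det) -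
        (Real.log ((M W).submatrix (e ∘ Sum.inl) (e ∘ Sum.inl) -
            (M W).submatrix (e ∘ Sum.inl) (e ∘ Sum.inr) * ((M W).submatrix (e ∘ Sum.inr) (e ∘ Sum.inr))⁻¹ *
              ((M W).submatrix (e ∘ Sum.inl) (e ∘ Sum.inr))ᴴ).det -
          Real.log ((M Z).submatrix (e ∘ Sum.inl) (e ∘ Sum.inl) -
            (M Z).submatrix (e ∘ Sum.inl) (e ∘ Sum.inr) * ((M Z).submatrix (e ∘ Sum.inr) (e ∘ Sum.inr))⁻¹ *
              ((M Z).submatrix (e ∘ Sum.inl) (e ∘ Sum.inr))ᴴ).det)) := by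
  rw [log_det_eq_add_of_equiv hU e, log_det_eq_add_of_equiv hV e, log_det_eq_add_of_equiv hW e, log_det_eq_add_of_equiv hZ e]
  ring

end FourPoint

end Summit.QuantumFields.YangMills.Theorems.FluctuationComparisonRegPrIntLS2BetaLogDetSchurStep

end
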